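import Literature.NumberTheory.EllipticCurves.TateCurve.FormalEulerProductDefs
import Literature.NumberTheory.EllipticCurves.TateCurve.LaurentSeriesIdentity2
import Literature.NumberTheory.EllipticCurves.TateCurve.TateFormalSeries
import HarnessLib

/-!
# The formal theta relation of the Tate curve in `ℤ[u₁^{±1},u₂^{±1}]⟦q⟧` (definitions)
# (Silverman, *Advanced Topics*, Prop. V.3.2 (b)(i), PDF pp. 399–400)

Topic `Literature/NumberTheory/EllipticCurves/TateCurve`, namespace
`Literature.NumberTheory.EllipticCurves.TateCurve` (cell `bsd-eis`, seat `bsd-eis-k5-c4` g3; step T1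
of the discharge of `SteinWuthrich2013.exists_isSplitMultCanonical`).

Silverman, Prop. V.3.2 (b)(i) [our reading, with the normalised
`θ(u) = (1−u)∏(1−qⁿu)(1−qⁿu⁻¹)/(1−qⁿ)²` of (a)]: `X(u₁) − X(u₂) = −u₂ θ(u₁u₂) θ(u₁u₂⁻¹)/(θ(u₁)²θ(u₂)²)`,
proved — like Thm. V.3.1 (c) — as an identity of `q`-series which holds over `ℂ`
(`℘(z₁) − ℘(z₂) = −σ(z₁+z₂)σ(z₁−z₂)/σ(z₁)²σ(z₂)²` and the `q`-product of `σ`, Thm. I.6.4) and hence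
formally, hence `p`-adically. This file DEFINES the formal relation in the two-variable transfer
ring `ℤ[u₂^{±1}][u₁^{±1}]⟦q⟧` of `LaurentSeriesIdentity2` (outer variable `T ↦ u₁`, inner
`C T ↦ u₂`), following `TateFormalAddition`:

* the monomials `monoU₁ = u₁`, `monoU₁inv = u₁⁻¹`, `monoU₂ = u₂`, `monoU₂inv = u₂⁻¹`;
* `thetaTilde m m' = (1 − m)·P̃(m)·P̃(m')` (`P̃ = eulerForm`; at `m' = m⁻¹` this is `P(1)²θ(m)`);
* `thetaRel = (X̃₁A₂² − X̃₂A₁²)·Θ̃(u₁)²Θ̃(u₂)² + u₂A₁²A₂²·P̃(1)⁴·Θ̃(u₁u₂)Θ̃(u₁u₂⁻¹)` with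
  `X̃ᵢ = xForm` along `ιᵢ` (`= (1−uᵢ)²X(uᵢ)`), `Aᵢ = 1 − uᵢ` — this is (b)(i) multiplied by
  `A₁²A₂²P(1)⁸`.

Definitions only; evaluation (`TateFormalTheta.lean`), vanishing and the `p`-adic relation follow.

## References
* [SilvermanATAEC1994] J. H. Silverman, *Advanced Topics in the Arithmetic of Elliptic Curves*,
  GTM 151, Springer 1994, Prop. V.3.2 (PDF pp. 399–400); proof of Thm. V.3.1 (c) (PDF pp. 397–398).
-/

noncomputable section

open LaurentPolynomial

namespace Literature.NumberTheory.EllipticCurves.TateCurve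

/-- The outer variable `u₁ ∈ ℤ[u₂^{±1}][u₁^{±1}]`. [cite: SilvermanATAEC1994, Prop. V.3.2 (b) (PDF p. 399)] -/
def monoU₁ : LaurentPoly₂ := T 1

/-- `u₁⁻¹`. [cite: SilvermanATAEC1994, Prop. V.3.2 (b) (PDF p. 399)] -/
def monoU₁inv : LaurentPoly₂ := T (-1)

/-- The inner variable `u₂ ∈ ℤ[u₂^{±1}][u₁^{±1}]`. [cite: SilvermanATAEC1994, Prop. V.3.2 (b) (PDF p. 399)] -/
def monoU₂ : LaurentPoly₂ := C (T 1)

/-- `u₂⁻¹`. [cite: SilvermanATAEC1994, Prop. V.3.2 (b) (PDF p. 399)] -/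
def monoU₂inv : LaurentPoly₂ := C (T (-1))

/-- `Θ̃(m) = (1 − m)·P̃(m)·P̃(m')` (with `m'` standing for `m⁻¹`): the theta function of
Prop. V.3.2 (a) times `P(1)²`, as a formal `q`-series. [cite: SilvermanATAEC1994, Prop. V.3.2 (a) (PDF p. 399)] -/
def thetaTilde (m m' : LaurentPoly₂) : LaurentQSeries₂ :=
  PowerSeries.C (1 - m) * eulerForm m * eulerForm m'

/-- **The formal theta relation** (b)(i) `× A₁²A₂²P(1)⁸`:
`(X̃₁A₂² − X̃₂A₁²)·Θ̃(u₁)²Θ̃(u₂)² + u₂A₁²A₂²·P̃(1)⁴·Θ̃(u₁u₂)Θ̃(u₁u₂⁻¹) ∈ ℤ[u₂^{±1}][u₁^{±1}]⟦q⟧`.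
[cite: SilvermanATAEC1994, Prop. V.3.2 (b) (PDF p. 399)] -/
def thetaRel : LaurentQSeries₂ :=
  (PowerSeries.map ι₁ xForm * PowerSeries.C ((1 - monoU₂) ^ 2)
      - PowerSeries.map ι₂ xForm * PowerSeries.C ((1 - monoU₁) ^ 2))
    * thetaTilde monoU₁ monoU₁inv ^ 2 * thetaTilde monoU₂ monoU₂inv ^ 2
  + PowerSeries.C (monoU₂ * (1 - monoU₁) ^ 2 * (1 - monoU₂) ^ 2) * eulerForm 1 ^ 4
    * thetaTilde (monoU₁ * monoU₂) (monoU₁inv * monoU₂inv)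
    * thetaTilde (monoU₁ * monoU₂inv) (monoU₁inv * monoU₂)

end Literature.NumberTheory.EllipticCurves.TateCurve

end
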